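import Summits.BirchSwinnertonDyer.BirchSwinnertonDyer.Theorems.ByReductionTypeAtTwoFineSelmerConjAAtTwoAdditivePotGoodNarrowRankCertificate316LayerOne
import Literature.NumberTheory.NumberFields.CyclotomicTwoTowerLayerPolynomials
import HarnessLib

/-!
# Route `ByReductionTypeAtTwo` (rung K4), crux C1″ `FineSelmerConjAAtTwoAdditivePotGood` (item stmt-BirchSwinnertonDyer-22615):
# THE LAYER-`2` FIELD `A₂ = ℚ(θ) ⊔ ℚ_2 = ℚ(θ, √(2+√2))` OF THE CUBIC FIELD OF DISCRIMINANT `316` (`θ³ − θ² − 4θ + 2 = 0`, point field of the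
# census row `261648q1`), PART A — totally real of degree `12` and its twelve real embeddings by COUNTING (KERNEL)
# (a `--supports 22615` file; seat `bsd-2adic-k4-w1` GEN 11; the degree-`12` twin of `…316LayerOne`)

HONEST FRAMING (cell `bsd-2adic`, D-0036/D-0054/D-0152): KERNEL theorems about ONE totally real number field of degree `12`,
`A₂ = ℚ(θ) ⊔ ℚ_2` (`ℚ_2 = ℚ(ζ₁₆ + ζ₁₆⁻¹)` the second layer of the cyclotomic `ℤ₂`-extension of `ℚ`); no elliptic curve, no named fact, no `sorry`,
no definition. Closes nothing at the `∀`-level; nothing booked; BSD is not proved by any of this.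

The basic data of `A₂` (totally real, `[A₂ : ℚ] = 12`) come from the restricted cyclotomic tower of `ℚ(θ)` (`isTotallyReal_layer`,
`finrank_layer_restrict`, layer `2`); `A₂ = ℚ(θ)(e)` for any root `e ∈ ℚ_2` of `Ψ₂ = X⁴ − 4X² + 2` (`NestedSqrtTwo.finrank_adjoin_eq_of_odd_finrank`:
`Ψ₂` stays irreducible over the odd-degree field `ℚ(θ)`), so `ρ ↦ (ρ|_{ℚ(θ)}, ρ(e))` is injective on the `12` real embeddings with image in
`Emb(ℚ(θ)) × {real roots of Ψ₂}` (`≤ 3·4` elements): every pair `(φ, z)` with `Ψ₂(z) = 0` is realised.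

* `layer_two_basics_d316` — `A₂` totally real, `[A₂ : ℚ] = 12`, `[ℚ(θ) : ℚ] = 3`.
* `exists_ringHom_sup_layer_two_d316` — every pair `(φ, z)`, `Ψ₂(z) = 0`, is `(ρ|_{ℚ(θ)}, ρ(e))` for a real embedding `ρ` of `A₂`.

References: [Washington1997] §13.1 (`ℚ_2 = ℚ(ζ₁₆)⁺`, `K_n = Kℚ_n`), Prop. 13.2; [FrohlichTaylor1990] Ch. V §1; [Cohen1993] §4.1.3.
-/

set_option autoImplicit false
-- sibling precedent: the directory name repeats the summit name
set_option linter.dupNamespace false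

noncomputable section

open scoped Classical IntermediateField NumberField Polynomial

namespace Summit.BirchSwinnertonDyer.BirchSwinnertonDyer.Theorems.AddKatoTwo

open Polynomial IsDedekindDomain NumberField Field IntermediateField
  Literature.NumberTheory.EllipticCurves Literature.NumberTheory.EllipticCurves.ZpExtension
  Literature.NumberTheory.IwasawaTheory Literature.NumberTheory.NumberFields
  Literature.NumberTheory.GaloisRepresentations Literature.Geometry.Kaehler.ComplexTorus

variable {θ : AlgebraicClosure ℚ}

set_option maxHeartbeats 400000 in
/-- **The basic data of `A₂ = ℚ(θ) ⊔ ℚ_2` for `d = 316`: totally real, degree `12`, and `[ℚ(θ):ℚ] = 3`** — from the restricted cyclotomic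
`ℤ₂`-tower of `ℚ(θ)` (odd degree): its second layer is `≅ ℚ(θ) ⊔ ℚ_2`, totally real as a layer of a `ℤ₂`-extension of a totally real field, of
degree `3·2²`. [cite: Washington1997, §13.1 and Prop. 13.2] -/
theorem layer_two_basics_d316 (hθ : aeval θ (Cubic.toPoly ⟨1, ((-1 : ℤ) : ℚ), ((-4 : ℤ) : ℚ), ((2 : ℤ) : ℚ)⟩) = 0) :
    haveI : FiniteDimensional ℚ ↥ℚ⟮θ⟯ :=
      IntermediateField.adjoin.finiteDimensional ⟨_, Cubic.monic_of_a_eq_one', by rwa [← aeval_def]⟩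
    haveI : FiniteDimensional ℚ ↥((CyclotomicZp.zpExtension 2).layer 2) := (CyclotomicZp.zpExtension 2).finiteDimensional_layer_holds 2
    haveI : NumberField ↥(ℚ⟮θ⟯ ⊔ (CyclotomicZp.zpExtension 2).layer 2) := NumberField.mk
    IsTotallyReal ↥(ℚ⟮θ⟯ ⊔ (CyclotomicZp.zpExtension 2).layer 2) ∧
      Module.finrank ℚ ↥(ℚ⟮θ⟯ ⊔ (CyclotomicZp.zpExtension 2).layer 2) = 12 ∧ Module.finrank ℚ ↥ℚ⟮θ⟯ = 3 := by
  haveI : FiniteDimensional ℚ ↥ℚ⟮θ⟯ :=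
    IntermediateField.adjoin.finiteDimensional ⟨_, Cubic.monic_of_a_eq_one', by rwa [← aeval_def]⟩
  haveI : FiniteDimensional ℚ ↥((CyclotomicZp.zpExtension 2).layer 2) := (CyclotomicZp.zpExtension 2).finiteDimensional_layer_holds 2
  haveI : NumberField ↥ℚ⟮θ⟯ := NumberField.mk
  haveI : NumberField ↥(ℚ⟮θ⟯ ⊔ (CyclotomicZp.zpExtension 2).layer 2) := NumberField.mk
  haveI : IsTotallyReal ↥ℚ⟮θ⟯ := isTotallyReal_adjoin_d316 hθ
  set κ := CyclotomicZp.zpExtension 2 with hκdef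
  have h3 : Module.finrank ℚ ↥ℚ⟮θ⟯ = 3 := finrank_adjoin_eq_three_of_irreducible irreducible_cubic_d316p hθ
  have hodd3 : Odd (Module.finrank ℚ ↥ℚ⟮θ⟯) := by rw [h3]; decide
  have hsurj := surjective_comp_absGaloisRestrict_cyclotomicZp_of_odd ℚ⟮θ⟯ hodd3
  set κE := κ.restrict ↥ℚ⟮θ⟯ hsurj with hκE
  haveI : FiniteDimensional ↥ℚ⟮θ⟯ (κE.layer 2) := κE.finiteDimensional_layer_holds 2
  haveI : NumberField (κE.layer 2) := NumberField.of_module_finite ↥ℚ⟮θ⟯ _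
  obtain ⟨f⟩ := nonempty_algEquiv_layer_restrict_fieldRange_sup_layer κ ↥ℚ⟮θ⟯ hsurj (ℚ⟮θ⟯).val 2
  have hrange : (ℚ⟮θ⟯).val.fieldRange ⊔ κ.layer 2 = ℚ⟮θ⟯ ⊔ κ.layer 2 := by rw [fieldRange_val]
  set e : ↥(κE.layer 2) ≃ₐ[ℚ] ↥(ℚ⟮θ⟯ ⊔ κ.layer 2) := f.trans (equivOfEq hrange) with hedef
  haveI : IsTotallyReal ↥(κE.layer 2) := isTotallyReal_layer κE 2
  refine ⟨IsTotallyReal.ofRingEquiv e.toRingEquiv, ?_, h3⟩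
  rw [← e.toLinearEquiv.finrank_eq, finrank_layer_restrict κ ↥ℚ⟮θ⟯ hsurj 2, h3]
  norm_num

set_option maxHeartbeats 800000 in
/-- **The real embeddings of `A₂ = ℚ(θ) ⊔ ℚ_2` (`d = 316`) realise every pair `(φ, z)`**, `φ` a real embedding of `ℚ(θ)` and `z` a real root of
`Ψ₂ = X⁴ − 4X² + 2`, for any root `e ∈ ℚ_2` of `Ψ₂`: `A₂ = ℚ(θ)(e)` (`[ℚ(θ)(e) : ℚ(θ)] = 4`, `Ψ₂` irreducible over the cubic field), so
`ρ ↦ (ρ|_{ℚ(θ)}, ρ(e))` is injective on the `12` real embeddings, with image in `Emb(ℚ(θ)) × {roots of Ψ₂ in ℝ}`, a set of at most `12` elements.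
[cite: FrohlichTaylor1990, Ch. V §1 ("the embeddings N ↪ ℝ"), p. 163] [cite: Washington1997, §13.1] [cite: Cohen1993, §4.1.3] -/
theorem exists_ringHom_sup_layer_two_d316 (hθ : aeval θ (Cubic.toPoly ⟨1, ((-1 : ℤ) : ℚ), ((-4 : ℤ) : ℚ), ((2 : ℤ) : ℚ)⟩) = 0)
    {e : AlgebraicClosure ℚ} (he : e ∈ (CyclotomicZp.zpExtension 2).layer 2) (he0 : (fun x : AlgebraicClosure ℚ => x ^ 2 - 2)^[2] e = 0)
    (φ : ↥ℚ⟮θ⟯ →+* ℝ) (z : ℝ) (hz : (fun x : ℝ => x ^ 2 - 2)^[2] z = 0) :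
    ∃ ρ : ↥(ℚ⟮θ⟯ ⊔ (CyclotomicZp.zpExtension 2).layer 2) →+* ℝ,
      (∀ c : ↥ℚ⟮θ⟯, ρ (inclusion (le_sup_left : ℚ⟮θ⟯ ≤ ℚ⟮θ⟯ ⊔ (CyclotomicZp.zpExtension 2).layer 2) c) = φ c) ∧
      ρ ⟨e, (le_sup_right : (CyclotomicZp.zpExtension 2).layer 2 ≤ _) he⟩ = z := by
  haveI : FiniteDimensional ℚ ↥ℚ⟮θ⟯ :=
    IntermediateField.adjoin.finiteDimensional ⟨_, Cubic.monic_of_a_eq_one', by rwa [← aeval_def]⟩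
  haveI : FiniteDimensional ℚ ↥((CyclotomicZp.zpExtension 2).layer 2) := (CyclotomicZp.zpExtension 2).finiteDimensional_layer_holds 2
  haveI : NumberField ↥ℚ⟮θ⟯ := NumberField.mk
  haveI : NumberField ↥(ℚ⟮θ⟯ ⊔ (CyclotomicZp.zpExtension 2).layer 2) := NumberField.mk
  obtain ⟨hreal, hfinA, h3⟩ := layer_two_basics_d316 hθ
  haveI := hreal
  have hodd3 : Odd (Module.finrank ℚ ↥ℚ⟮θ⟯) := by rw [h3]; decide
  have hKA : ℚ⟮θ⟯ ≤ ℚ⟮θ⟯ ⊔ ((CyclotomicZp.zpExtension 2).layer 2) := le_sup_left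
  have heA : e ∈ ℚ⟮θ⟯ ⊔ ((CyclotomicZp.zpExtension 2).layer 2) :=
    (le_sup_right : ((CyclotomicZp.zpExtension 2).layer 2) ≤ ℚ⟮θ⟯ ⊔ ((CyclotomicZp.zpExtension 2).layer 2)) he
  set e' : ↥(ℚ⟮θ⟯ ⊔ ((CyclotomicZp.zpExtension 2).layer 2)) := ⟨e, heA⟩ with he'def
  have he'0 : (fun x : ↥(ℚ⟮θ⟯ ⊔ ((CyclotomicZp.zpExtension 2).layer 2)) => x ^ 2 - 2)^[2] e' = 0 := by
    apply (algebraMap ↥(ℚ⟮θ⟯ ⊔ ((CyclotomicZp.zpExtension 2).layer 2)) (AlgebraicClosure ℚ)).injective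
    rw [NestedSqrtTwo.map_iterate, map_zero]
    exact he0
  letI : Algebra ℚ⟮θ⟯ ↥(ℚ⟮θ⟯ ⊔ ((CyclotomicZp.zpExtension 2).layer 2)) := (inclusion hKA).toRingHom.toAlgebra
  have halg : ∀ c : ℚ⟮θ⟯, algebraMap ℚ⟮θ⟯ ↥(ℚ⟮θ⟯ ⊔ ((CyclotomicZp.zpExtension 2).layer 2)) c = inclusion hKA c := fun _ => rfl
  haveI : IsScalarTower ℚ ℚ⟮θ⟯ ↥(ℚ⟮θ⟯ ⊔ ((CyclotomicZp.zpExtension 2).layer 2)) :=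
    IsScalarTower.of_algebraMap_eq fun q => ((inclusion hKA).commutes q).symm
  haveI : Module.Finite ℚ⟮θ⟯ ↥(ℚ⟮θ⟯ ⊔ ((CyclotomicZp.zpExtension 2).layer 2)) := Module.Finite.of_restrictScalars_finite ℚ ℚ⟮θ⟯ _
  have hdeg : Module.finrank ℚ⟮θ⟯ ↥(ℚ⟮θ⟯ ⊔ ((CyclotomicZp.zpExtension 2).layer 2)) = 4 := by
    have htower := Module.finrank_mul_finrank ℚ ℚ⟮θ⟯ ↥(ℚ⟮θ⟯ ⊔ ((CyclotomicZp.zpExtension 2).layer 2))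
    rw [h3, hfinA] at htower
    omega
  -- `A₂ = ℚ(θ)(e')`
  have htint : IsIntegral ℚ⟮θ⟯ e' := (Algebra.IsIntegral.isIntegral (R := ℚ) e').tower_top
  have hgen : IntermediateField.adjoin ℚ⟮θ⟯ ({e'} : Set ↥(ℚ⟮θ⟯ ⊔ ((CyclotomicZp.zpExtension 2).layer 2))) = ⊤ := by
    refine IntermediateField.eq_of_le_of_finrank_eq le_top ?_
    rw [NestedSqrtTwo.finrank_adjoin_eq_of_odd_finrank hodd3 e' he'0, IntermediateField.finrank_top', hdeg]
    norm_num
  have hpoly : ∀ w : ↥(ℚ⟮θ⟯ ⊔ ((CyclotomicZp.zpExtension 2).layer 2)), ∃ f : ℚ⟮θ⟯[X], w = aeval e' f := by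
    intro w
    have hw : w ∈ (IntermediateField.adjoin ℚ⟮θ⟯ ({e'} : Set ↥(ℚ⟮θ⟯ ⊔ ((CyclotomicZp.zpExtension 2).layer 2)))).toSubalgebra := by
      rw [hgen, IntermediateField.top_toSubalgebra]; exact Algebra.mem_top
    rw [IntermediateField.adjoin_simple_toSubalgebra_of_isAlgebraic htint.isAlgebraic, Algebra.adjoin_singleton_eq_range_aeval] at hw
    obtain ⟨f, hf⟩ := hw
    exact ⟨f, hf.symm⟩
  have hinj : ∀ ρ ρ' : ↥(ℚ⟮θ⟯ ⊔ ((CyclotomicZp.zpExtension 2).layer 2)) →+* ℝ,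
      ρ.comp (algebraMap ℚ⟮θ⟯ ↥(ℚ⟮θ⟯ ⊔ ((CyclotomicZp.zpExtension 2).layer 2))) =
        ρ'.comp (algebraMap ℚ⟮θ⟯ ↥(ℚ⟮θ⟯ ⊔ ((CyclotomicZp.zpExtension 2).layer 2))) → ρ e' = ρ' e' → ρ = ρ' := by
    intro ρ ρ' hc hval
    refine RingHom.ext fun w => ?_
    obtain ⟨f, rfl⟩ := hpoly w
    rw [aeval_def, hom_eval₂, hom_eval₂, hc, hval]
  -- the real roots of `Ψ₂`
  set T : Finset ℝ := (((X ^ 2 - C 2 : ℝ[X]).comp)^[2] X).roots.toFinset with hT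
  have hTcard : T.card ≤ 4 := by
    refine (Multiset.toFinset_card_le _).trans ?_
    have h := Polynomial.card_roots' (((X ^ 2 - C 2 : ℝ[X]).comp)^[2] X)
    rwa [NestedSqrtTwo.natDegree_eq] at h
  have hmemT : ∀ w : ℝ, (fun x : ℝ => x ^ 2 - 2)^[2] w = 0 → w ∈ T := by
    intro w hw
    rw [hT, Multiset.mem_toFinset, Polynomial.mem_roots (NestedSqrtTwo.ne_zero 2), Polynomial.IsRoot.def,
      NestedSqrtTwo.eval_eq_iterate]
    exact hw
  -- counting
  have hcardA : Fintype.card (↥(ℚ⟮θ⟯ ⊔ ((CyclotomicZp.zpExtension 2).layer 2)) →+* ℝ) = 12 := by rw [card_realEmbeddings, hfinA]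
  haveI : IsTotallyReal ↥ℚ⟮θ⟯ := isTotallyReal_adjoin_d316 hθ
  have hcardK : Fintype.card (↥ℚ⟮θ⟯ →+* ℝ) = 3 := by rw [card_realEmbeddings, h3]
  set Φ : (↥(ℚ⟮θ⟯ ⊔ ((CyclotomicZp.zpExtension 2).layer 2)) →+* ℝ) → (↥ℚ⟮θ⟯ →+* ℝ) × ℝ :=
    fun ρ => (ρ.comp (algebraMap ℚ⟮θ⟯ ↥(ℚ⟮θ⟯ ⊔ ((CyclotomicZp.zpExtension 2).layer 2))), ρ e') with hΦ
  set S : Finset ((↥ℚ⟮θ⟯ →+* ℝ) × ℝ) := (Finset.univ : Finset (↥ℚ⟮θ⟯ →+* ℝ)) ×ˢ T with hS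
  have hΦinj : Function.Injective Φ := fun ρ ρ' h => hinj ρ ρ' (congrArg Prod.fst h) (congrArg Prod.snd h)
  have hsub : Finset.univ.image Φ ⊆ S := by
    intro p hp
    obtain ⟨ρ, -, rfl⟩ := Finset.mem_image.mp hp
    rw [hS, Finset.mem_product]
    refine ⟨Finset.mem_univ _, hmemT _ ?_⟩
    rw [← NestedSqrtTwo.map_iterate, he'0, map_zero]
  have hcardS : S.card ≤ 12 := by
    rw [hS, Finset.card_product, Finset.card_univ, hcardK]
    omega
  have hcardI : (Finset.univ.image Φ).card = 12 := by
    rw [Finset.card_image_of_injective _ hΦinj, Finset.card_univ, hcardA]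
  have heq : Finset.univ.image Φ = S := Finset.eq_of_subset_of_card_le hsub (by rw [hcardI]; exact hcardS)
  have hmem : (φ, z) ∈ Finset.univ.image Φ := by
    rw [heq, hS, Finset.mem_product]
    exact ⟨Finset.mem_univ _, hmemT z hz⟩
  obtain ⟨ρ, -, hρ⟩ := Finset.mem_image.mp hmem
  refine ⟨ρ, fun c => ?_, congrArg Prod.snd hρ⟩
  have h1 := congrArg Prod.fst hρ
  simp only [hΦ] at h1
  rw [← halg, ← RingHom.comp_apply, h1]

/-! ## §2 `e² − 2 ∈ ℚ_1` and the integers `b`, `ξ`, `p` of `A₂` -/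

/-- For a root `e` of `Ψ₂` (in `ℚ̄`): `e² − 2 ∈ ℚ_1` (it is a square root of `2` in `ℚ_2`, and `ℚ_1 ∋ √2`) and `(e² − 2)² = 2`.
[cite: Washington1997, §13.1 (`ℚ_1 = ℚ(√2) ⊂ ℚ_2 = ℚ(√(2+√2))`)] -/
theorem sq_sub_two_mem_layer_one_d316 {e : AlgebraicClosure ℚ}
    (he0 : (fun x : AlgebraicClosure ℚ => x ^ 2 - 2)^[2] e = 0) :
    e ^ 2 - 2 ∈ (CyclotomicZp.zpExtension 2).layer 1 ∧ (e ^ 2 - 2) ^ 2 = 2 := by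
  have h2 : (e ^ 2 - 2) ^ 2 = 2 := by
    have h := he0
    simp only [Function.iterate_succ, Function.iterate_zero, Function.comp_apply, id_eq] at h
    linear_combination h
  obtain ⟨t₀, ht₀, ht₀2⟩ := CyclotomicZp.exists_mem_layer_one_sq_eq_two_zpExtension
  refine ⟨?_, h2⟩
  rcases sq_eq_sq_iff_eq_or_eq_neg.mp (h2.trans ht₀2.symm) with h | h
  · rw [h]; exact ht₀
  · rw [h]; exact neg_mem ht₀

set_option maxHeartbeats 800000 in
/-- **The integers `b = θ`, `ξ = √2/θ`, `p = e/(1 + ξ)` of `A₂ = ℚ(θ) ⊔ ℚ_2`** (`e ∈ ℚ_2` a root of `Ψ₂`, `t = e² − 2 = √2`): values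
`ξθ = t`, `p(1 + ξ) = e`, and relations `θ³ − θ² − 4θ + 2 = 0`, `ξ² = 9 + θ − 2θ²`, `p² = 4 − 10θ + 4θ² + ξ(−5 + 13θ − 5θ²)`
(`𝓞 A₂ = ℤ[θ, ξ, p]` by discriminants — not needed); `p = e((θ² − θ) + (1 − θ)t)/2` is integral as a square root of an integer. KERNEL.
[cite: Cohen1993, §4.8.2 and §6.3] [cite: Washington1997, §13.1] -/
theorem layer_two_integers_d316 (hθ : aeval θ (Cubic.toPoly ⟨1, ((-1 : ℤ) : ℚ), ((-4 : ℤ) : ℚ), ((2 : ℤ) : ℚ)⟩) = 0)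
    {e : AlgebraicClosure ℚ} (he : e ∈ (CyclotomicZp.zpExtension 2).layer 2) (he0 : (fun x : AlgebraicClosure ℚ => x ^ 2 - 2)^[2] e = 0) :
    haveI : FiniteDimensional ℚ ↥ℚ⟮θ⟯ :=
      IntermediateField.adjoin.finiteDimensional ⟨_, Cubic.monic_of_a_eq_one', by rwa [← aeval_def]⟩
    haveI : FiniteDimensional ℚ ↥((CyclotomicZp.zpExtension 2).layer 2) := (CyclotomicZp.zpExtension 2).finiteDimensional_layer_holds 2
    ∃ bB xB pB : 𝓞 ↥(ℚ⟮θ⟯ ⊔ (CyclotomicZp.zpExtension 2).layer 2),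
      (bB : ↥(ℚ⟮θ⟯ ⊔ (CyclotomicZp.zpExtension 2).layer 2)) =
          inclusion (le_sup_left : ℚ⟮θ⟯ ≤ ℚ⟮θ⟯ ⊔ (CyclotomicZp.zpExtension 2).layer 2) (AdjoinSimple.gen ℚ θ) ∧
      (xB : ↥(ℚ⟮θ⟯ ⊔ (CyclotomicZp.zpExtension 2).layer 2)) *
          inclusion (le_sup_left : ℚ⟮θ⟯ ≤ ℚ⟮θ⟯ ⊔ (CyclotomicZp.zpExtension 2).layer 2) (AdjoinSimple.gen ℚ θ) =
        (⟨e, (le_sup_right : (CyclotomicZp.zpExtension 2).layer 2 ≤ _) he⟩ : ↥(ℚ⟮θ⟯ ⊔ (CyclotomicZp.zpExtension 2).layer 2)) ^ 2 - 2 ∧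
      (pB : ↥(ℚ⟮θ⟯ ⊔ (CyclotomicZp.zpExtension 2).layer 2)) * (1 + (xB : ↥(ℚ⟮θ⟯ ⊔ (CyclotomicZp.zpExtension 2).layer 2))) =
        ⟨e, (le_sup_right : (CyclotomicZp.zpExtension 2).layer 2 ≤ _) he⟩ ∧
      2 * (xB : ↥(ℚ⟮θ⟯ ⊔ (CyclotomicZp.zpExtension 2).layer 2)) =
        ((⟨e, (le_sup_right : (CyclotomicZp.zpExtension 2).layer 2 ≤ _) he⟩ : ↥(ℚ⟮θ⟯ ⊔ (CyclotomicZp.zpExtension 2).layer 2)) ^ 2 - 2) *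
          (4 + inclusion (le_sup_left : ℚ⟮θ⟯ ≤ ℚ⟮θ⟯ ⊔ (CyclotomicZp.zpExtension 2).layer 2) (AdjoinSimple.gen ℚ θ) -
            inclusion (le_sup_left : ℚ⟮θ⟯ ≤ ℚ⟮θ⟯ ⊔ (CyclotomicZp.zpExtension 2).layer 2) (AdjoinSimple.gen ℚ θ) ^ 2) ∧
      2 * (pB : ↥(ℚ⟮θ⟯ ⊔ (CyclotomicZp.zpExtension 2).layer 2)) =
        (⟨e, (le_sup_right : (CyclotomicZp.zpExtension 2).layer 2 ≤ _) he⟩ : ↥(ℚ⟮θ⟯ ⊔ (CyclotomicZp.zpExtension 2).layer 2)) *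
          ((inclusion (le_sup_left : ℚ⟮θ⟯ ≤ ℚ⟮θ⟯ ⊔ (CyclotomicZp.zpExtension 2).layer 2) (AdjoinSimple.gen ℚ θ) ^ 2 -
              inclusion (le_sup_left : ℚ⟮θ⟯ ≤ ℚ⟮θ⟯ ⊔ (CyclotomicZp.zpExtension 2).layer 2) (AdjoinSimple.gen ℚ θ)) +
            (1 - inclusion (le_sup_left : ℚ⟮θ⟯ ≤ ℚ⟮θ⟯ ⊔ (CyclotomicZp.zpExtension 2).layer 2) (AdjoinSimple.gen ℚ θ)) *
              (((⟨e, (le_sup_right : (CyclotomicZp.zpExtension 2).layer 2 ≤ _) he⟩ : ↥(ℚ⟮θ⟯ ⊔ (CyclotomicZp.zpExtension 2).layer 2)) ^ 2 - 2))) ∧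
      bB ^ 3 - bB ^ 2 - 4 * bB + 2 = 0 ∧ xB ^ 2 = 9 + bB - 2 * bB ^ 2 ∧
      pB ^ 2 = 4 - 10 * bB + 4 * bB ^ 2 - 5 * xB + 13 * bB * xB - 5 * bB ^ 2 * xB := by
  haveI : FiniteDimensional ℚ ↥ℚ⟮θ⟯ :=
    IntermediateField.adjoin.finiteDimensional ⟨_, Cubic.monic_of_a_eq_one', by rwa [← aeval_def]⟩
  haveI : FiniteDimensional ℚ ↥((CyclotomicZp.zpExtension 2).layer 2) := (CyclotomicZp.zpExtension 2).finiteDimensional_layer_holds 2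
  haveI : NumberField ↥ℚ⟮θ⟯ := NumberField.mk
  haveI : NumberField ↥(ℚ⟮θ⟯ ⊔ (CyclotomicZp.zpExtension 2).layer 2) := NumberField.mk
  have hKA : ℚ⟮θ⟯ ≤ ℚ⟮θ⟯ ⊔ (CyclotomicZp.zpExtension 2).layer 2 := le_sup_left
  have heA : e ∈ ℚ⟮θ⟯ ⊔ (CyclotomicZp.zpExtension 2).layer 2 := (le_sup_right : (CyclotomicZp.zpExtension 2).layer 2 ≤ _) he
  set e' : ↥(ℚ⟮θ⟯ ⊔ (CyclotomicZp.zpExtension 2).layer 2) := ⟨e, heA⟩ with he'def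
  obtain ⟨-, ht2⟩ := sq_sub_two_mem_layer_one_d316 he0
  set t' : ↥(ℚ⟮θ⟯ ⊔ (CyclotomicZp.zpExtension 2).layer 2) := e' ^ 2 - 2 with ht'def
  have ht'2 : t' ^ 2 = 2 := by
    apply (algebraMap ↥(ℚ⟮θ⟯ ⊔ (CyclotomicZp.zpExtension 2).layer 2) (AlgebraicClosure ℚ)).injective
    rw [map_pow, map_ofNat, ht'def, map_sub, map_pow, map_ofNat]
    exact ht2
  have he'2 : e' ^ 2 = 2 + t' := by rw [ht'def]; ring
  letI : Algebra ↥ℚ⟮θ⟯ ↥(ℚ⟮θ⟯ ⊔ (CyclotomicZp.zpExtension 2).layer 2) := (inclusion hKA).toRingHom.toAlgebra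
  have halg : ∀ c : ↥ℚ⟮θ⟯, algebraMap ↥ℚ⟮θ⟯ ↥(ℚ⟮θ⟯ ⊔ (CyclotomicZp.zpExtension 2).layer 2) c = inclusion hKA c := fun _ => rfl
  haveI : IsScalarTower ℚ ↥ℚ⟮θ⟯ ↥(ℚ⟮θ⟯ ⊔ (CyclotomicZp.zpExtension 2).layer 2) :=
    IsScalarTower.of_algebraMap_eq fun q => ((inclusion hKA).commutes q).symm
  -- `b`
  obtain ⟨b, hbθ, hb⟩ := exists_ringOfIntegers_cubic_root (p := -1) (q := -4) (r := 2) hθ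
  have hb' : b ^ 3 - b ^ 2 - 4 * b + 2 = 0 := by push_cast at hb; linear_combination hb
  have hbgen : algebraMap (𝓞 ↥ℚ⟮θ⟯) ↥ℚ⟮θ⟯ b = AdjoinSimple.gen ℚ θ := Subtype.ext hbθ
  set θ' : ↥(ℚ⟮θ⟯ ⊔ (CyclotomicZp.zpExtension 2).layer 2) := inclusion hKA (AdjoinSimple.gen ℚ θ) with hθ'def
  set bB : 𝓞 ↥(ℚ⟮θ⟯ ⊔ (CyclotomicZp.zpExtension 2).layer 2) :=
    algebraMap (𝓞 ↥ℚ⟮θ⟯) (𝓞 ↥(ℚ⟮θ⟯ ⊔ (CyclotomicZp.zpExtension 2).layer 2)) b with hbBdef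
  have RbB : bB ^ 3 - bB ^ 2 - 4 * bB + 2 = 0 := by
    have h := congrArg (algebraMap (𝓞 ↥ℚ⟮θ⟯) (𝓞 ↥(ℚ⟮θ⟯ ⊔ (CyclotomicZp.zpExtension 2).layer 2))) hb'
    simp only [map_add, map_sub, map_mul, map_pow, map_ofNat, map_zero] at h; exact h
  have hbBval : algebraMap (𝓞 ↥(ℚ⟮θ⟯ ⊔ (CyclotomicZp.zpExtension 2).layer 2)) ↥(ℚ⟮θ⟯ ⊔ (CyclotomicZp.zpExtension 2).layer 2) bB = θ' := by
    rw [hbBdef, hθ'def, ← IsScalarTower.algebraMap_apply,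
      IsScalarTower.algebraMap_apply (𝓞 ↥ℚ⟮θ⟯) ↥ℚ⟮θ⟯ ↥(ℚ⟮θ⟯ ⊔ (CyclotomicZp.zpExtension 2).layer 2), hbgen, halg]
  have hθ'rel : θ' ^ 3 - θ' ^ 2 - 4 * θ' + 2 = 0 := by
    have h := congrArg (algebraMap (𝓞 ↥(ℚ⟮θ⟯ ⊔ (CyclotomicZp.zpExtension 2).layer 2)) ↥(ℚ⟮θ⟯ ⊔ (CyclotomicZp.zpExtension 2).layer 2)) RbB
    simp only [map_add, map_sub, map_mul, map_pow, map_ofNat, map_zero, hbBval] at h; exact h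
  -- `ξ`
  set ξ' : ↥(ℚ⟮θ⟯ ⊔ (CyclotomicZp.zpExtension 2).layer 2) := t' * (4 + θ' - θ' ^ 2) / 2 with hξ'def
  have hξθ : ξ' * θ' = t' := by
    rw [hξ'def]; field_simp; linear_combination (-t') * hθ'rel
  have hξsq : ξ' ^ 2 = 9 + θ' - 2 * θ' ^ 2 := by
    rw [hξ'def]; field_simp
    linear_combination ((4 + θ' - θ' ^ 2) ^ 2) * ht'2 + (2 * (θ' - 1)) * hθ'rel
  have hcoe9 : algebraMap (𝓞 ↥(ℚ⟮θ⟯ ⊔ (CyclotomicZp.zpExtension 2).layer 2)) ↥(ℚ⟮θ⟯ ⊔ (CyclotomicZp.zpExtension 2).layer 2)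
      (9 + bB - 2 * bB ^ 2) = 9 + θ' - 2 * θ' ^ 2 := by
    simp only [map_add, map_sub, map_mul, map_pow, map_ofNat, hbBval]
  have hξint : IsIntegral ℤ ξ' := by
    refine IsIntegral.of_pow two_pos ?_
    rw [hξsq, ← hcoe9]
    exact NumberField.RingOfIntegers.isIntegral_coe _
  set xB : 𝓞 ↥(ℚ⟮θ⟯ ⊔ (CyclotomicZp.zpExtension 2).layer 2) := ⟨ξ', hξint⟩ with hxBdef
  have hxBval : algebraMap (𝓞 ↥(ℚ⟮θ⟯ ⊔ (CyclotomicZp.zpExtension 2).layer 2)) ↥(ℚ⟮θ⟯ ⊔ (CyclotomicZp.zpExtension 2).layer 2) xB = ξ' := rfl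
  have RxB : xB ^ 2 = 9 + bB - 2 * bB ^ 2 := by
    apply NumberField.RingOfIntegers.coe_injective
    rw [map_pow, hxBval, hcoe9, hξsq]
  -- `p`
  set p' : ↥(ℚ⟮θ⟯ ⊔ (CyclotomicZp.zpExtension 2).layer 2) := e' * ((θ' ^ 2 - θ') + (1 - θ') * t') / 2 with hp'def
  have hpsq : p' ^ 2 = 4 - 10 * θ' + 4 * θ' ^ 2 - 5 * ξ' + 13 * θ' * ξ' - 5 * θ' ^ 2 * ξ' := by
    rw [hp'def, hξ'def]
    linear_combination (((13 : ↥(ℚ⟮θ⟯ ⊔ (CyclotomicZp.zpExtension 2).layer 2)) / 2) * t' + ((-1 : ↥(ℚ⟮θ⟯ ⊔ (CyclotomicZp.zpExtension 2).layer 2)) / 4) * e' ^ 2 + ((-5 : ↥(ℚ⟮θ⟯ ⊔ (CyclotomicZp.zpExtension 2).layer 2)) / 2) * θ' * t' + ((-1 : ↥(ℚ⟮θ⟯ ⊔ (CyclotomicZp.zpExtension 2).layer 2)) / 2) * t' * e' ^ 2 + ((1 : ↥(ℚ⟮θ⟯ ⊔ (CyclotomicZp.zpExtension 2).layer 2)) /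 4) * θ' * e' ^ 2) * hθ'rel + ((1 : ↥(ℚ⟮θ⟯ ⊔ (CyclotomicZp.zpExtension 2).layer 2)) + ((-5 : ↥(ℚ⟮θ⟯ ⊔ (CyclotomicZp.zpExtension 2).layer 2)) / 2) * θ' + ((1 : ↥(ℚ⟮θ⟯ ⊔ (CyclotomicZp.zpExtension 2).layer 2)) / 4) * e' ^ 2 + ((1 : ↥(ℚ⟮θ⟯ ⊔ (CyclotomicZp.zpExtension 2).layer 2)) / 2) * θ' ^ 2 + ((-1 : ↥(ℚ⟮θ⟯ ⊔ (CyclotomicZp.zpExtension 2).layer 2)) / 2) * θ' * e' ^ 2 + ((1 : ↥(ℚ⟮θ⟯ ⊔ (CyclotomicZp.zpExtension 2).layer 2)) / 4) * θ' ^ 2 * e' ^ 2) * ht'2 + ((1 : ↥(ℚ⟮θ⟯ ⊔ (CyclotomicZp.zpExtension 2).layer 2)) + (1 : ↥(ℚ⟮θ⟯ ⊔ (CyclotomicZp.zpExtension 2).layer 2)) * t' + ((-5 : ↥(ℚ⟮θ⟯ ⊔ (CyclotomicZp.zpExtension 2).layer 2)) / 2) * θ' + ((-5 : ↥(ℚ⟮θ⟯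 ⊔ (CyclotomicZp.zpExtension 2).layer 2)) / 2) * θ' * t' + ((3 : ↥(ℚ⟮θ⟯ ⊔ (CyclotomicZp.zpExtension 2).layer 2)) / 2) * θ' ^ 2 + ((1 : ↥(ℚ⟮θ⟯ ⊔ (CyclotomicZp.zpExtension 2).layer 2)) / 2) * θ' ^ 2 * t') * he'2
  have hcoeU : algebraMap (𝓞 ↥(ℚ⟮θ⟯ ⊔ (CyclotomicZp.zpExtension 2).layer 2)) ↥(ℚ⟮θ⟯ ⊔ (CyclotomicZp.zpExtension 2).layer 2)
      (4 - 10 * bB + 4 * bB ^ 2 - 5 * xB + 13 * bB * xB - 5 * bB ^ 2 * xB) =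
      4 - 10 * θ' + 4 * θ' ^ 2 - 5 * ξ' + 13 * θ' * ξ' - 5 * θ' ^ 2 * ξ' := by
    simp only [map_add, map_sub, map_mul, map_pow, map_ofNat, hbBval, hxBval]
  have hpint : IsIntegral ℤ p' := by
    refine IsIntegral.of_pow two_pos ?_
    rw [hpsq, ← hcoeU]
    exact NumberField.RingOfIntegers.isIntegral_coe _
  set pB : 𝓞 ↥(ℚ⟮θ⟯ ⊔ (CyclotomicZp.zpExtension 2).layer 2) := ⟨p', hpint⟩ with hpBdef
  have hpBval : algebraMap (𝓞 ↥(ℚ⟮θ⟯ ⊔ (CyclotomicZp.zpExtension 2).layer 2)) ↥(ℚ⟮θ⟯ ⊔ (CyclotomicZp.zpExtension 2).layer 2) pB = p' := rfl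
  have RpB : pB ^ 2 = 4 - 10 * bB + 4 * bB ^ 2 - 5 * xB + 13 * bB * xB - 5 * bB ^ 2 * xB := by
    apply NumberField.RingOfIntegers.coe_injective
    rw [map_pow, hpBval, hcoeU, hpsq]
  have hpe : p' * (1 + ξ') = e' := by
    rw [hp'def, hξ'def]
    linear_combination (((1 : ↥(ℚ⟮θ⟯ ⊔ (CyclotomicZp.zpExtension 2).layer 2)) / 4) * t' * e' + ((1 : ↥(ℚ⟮θ⟯ ⊔ (CyclotomicZp.zpExtension 2).layer 2)) / 4) * t' ^ 2 * e' + ((-1 : ↥(ℚ⟮θ⟯ ⊔ (CyclotomicZp.zpExtension 2).layer 2)) / 4) * θ' * t' * e') * hθ'rel + (((1 : ↥(ℚ⟮θ⟯ ⊔ (CyclotomicZp.zpExtension 2).layer 2)) / 2) * e' + ((1 : ↥(ℚ⟮θ⟯ ⊔ (CyclotomicZp.zpExtension 2).layer 2)) / 4) * θ' * e' + ((-1 : ↥(ℚ⟮θ⟯ ⊔ (CyclotomicZp.zpExtension 2).layer 2)) / 4) * θ' ^ 2 * e') * ht'2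
  refine ⟨bB, xB, pB, hbBval, ?_, ?_, ?_, ?_, RbB, RxB, RpB⟩
  · change ξ' * θ' = e' ^ 2 - 2
    rw [hξθ]
  · change p' * (1 + ξ') = e'
    exact hpe
  · change 2 * ξ' = (e' ^ 2 - 2) * (4 + θ' - θ' ^ 2)
    rw [hξ'def, ht'def]; ring
  · change 2 * p' = e' * ((θ' ^ 2 - θ') + (1 - θ') * (e' ^ 2 - 2))
    rw [hp'def, ht'def]; ring

end Summit.BirchSwinnertonDyer.BirchSwinnertonDyer.Theorems.AddKatoTwo

end
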